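import Summits.ResolutionOfSingularities.ResolutionOfSingularities.Theorems.EquisingularLiftEquisingularLiftNatResidueHypDefsE7
import HarnessLib

/-!
# [OURS · L1 W4.5(b) · EL♮ / EL♮(3)] RESIDUE HYPOTHESIS DEFS E8 — WIDTH TABLE D15 «ν-LIFT DOOR» (SHAPE (B), desk R77a): the supplier slot `NoseLift₀`,
# the initial-stage door `ReachLiftNoseSigmaPG₂` and the blob `NoseHypHostedNestEquinodalDirectCILiftSigmaPGBTriplePrime₂`

Typed by res-type-027 g24 as the SHAPE-ONLY DRAFT the desk asked for (R77 (c) 10:09Z → sizing idea-2 g30 ★ l.87080 (i)–(iii) → RULING R77a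
10:18:57Z «SHAPE (B) ADOPTED AS THE DRAFT SHAPE OF RECORD; COSTUME CHECK PASSED»; typer's note `D15-SHAPE-NOTE.md` fca587f9997d9a32 (T4)).
Customer-candidate #3 = H₉ = π_P(S₃,₃) (lead-1 g21 `EQUISINGULAR-NOSES.md` v1.0 41a541edd1dfc560 §6, THEOREM A §1–§2); D15 is DEALT only when its three
F4 legs are in — this file is FILED on the desk's DEAL word only.

WHAT.  (1) `NoseLift₀ k n H ι Z hZ S hS` — the ν-LIFT SUPPLIER SLOT, a CONCRETE `Prop` (idea-2 (i), centre-only; NO parameter, NO occurrence of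
`ELNatConclusionO`, no quantifier over words or chains — the desk's costume criterion of record, R77a (2)): for every admissible base `(O, θ)` and every
graded lift `φ` of the coordinates (the `ELNatConclusionO` block verbatim), IN THE CONCRETE INITIAL MODEL `ℙⁿ_O`: there is a centre `𝓢` (the SECTIONS
through the finite point set `S`, supplier-chosen) — `V(𝓢)` regular, `O`-flat, exact reduced trace `𝓢·𝒪_{ℙⁿ_k} = 𝓘⟨S⟩`, off the generic point of `Y` — such
that for EVERY blow-up `τ : X₁ ⟶ ℙⁿ_O` of `𝓢` and EVERY model square `(j₁, t₁)` of `X₁` over the downstairs blow-up `υ : F₂ ⟶ ℙⁿ_k` of `S` there is a centre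
`C` in `X₁` — `V(C)` regular, `O`-flat, exact reduced trace `C·𝒪_{F₂} = 𝓘⟨closure υ⁻¹(Z ∖ S)⟩` (the strict transform of the nose curve), off the generic point
of `Y`.  NO «generic fibre O-smooth» (no engine reads it), NO regularity of `Z̃` or of its strict transform (ν3ᵈ/ν3ᶜⁱ round SINGULAR curves), NO host.
Instances (census side, not here): ν3ᵈ / ν3ᶜⁱ with `S = ∅` (their explicit smoothings), FREE at stage 0 with `S = ∅` (✓ `embeddedCurveLiftFact_holds`),
THEOREM A with `S = T` (the triple points), sections `σ_q`, `C = St 𝒵` (lead-1 §2.4–§2.7).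
(2) `ReachLiftNoseSigmaPG₂ k n H ι T₁ F₉ β T₉ E₉` — the INITIAL-STAGE ν-LIFT DOOR with DOOR-OWNED point steps (shape (B); amendment (σ2): `S ⊆ S_Z` FREE,
`S = ∅` allowed): `E₉ = ∅`; a closed infinite nose curve `Z ⊆ T₁`, `T₁ ⊄ Z`, curve clause, (N1); a closed point set `S` inside the image of the NON-REGULAR
locus of `Z̃`; the slot `NoseLift₀ k n H ι Z hZ S hS`; then the downstairs word «blow up `S` (`υ`), [rev2: curve clause for the strict transform `closure υ⁻¹(Z ∖ S)`], blow it up (`υ'`),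
then a B‴ tail with the ΣPG rule list VERBATIM (`TowerPtRegB₄ → TowerPtRamB₄ → TowerRoundBTriplePrime → TowerSecRoundSigma → TowerPRamGamma`, stage
arguments `F₂ F₃ υ'`)», `β = γ' ≫ υ' ≫ υ`.  (3) the blob `NoseHypHostedNestEquinodalDirectCILiftSigmaPGBTriplePrime₂ k n H ι` = ✓ the ΣPG blob (…DefsE7
:165–:205) VERBATIM with the initial-stage menu widened by ONE disjunct: «((ν4 ∨ ν3ᵈΣPG) ∨ ν3ᶜⁱΣPG) ∨ νLIFT».  (4) pure logic: ΣPG-blob ⇒ this blob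
(`…LiftSigmaPG…₂_of_directCISigmaPG₂`), the D15 REPLACE lemma «¬(ΣPG-blob) ↦ ¬(this blob)» in consumable form
(`not_noseHypHostedNestEquinodalDirectCISigmaPGBTriplePrime₂_of_not_liftSigmaPG₂`), its Σ-level twin and the chain down to `NoseHypPointsFirstBTriplePrime`.
Engine side (not here; nose-w1 g7 per R77a (4)): ONE composite initial-stage twin «`|S|` point steps with the slot's PRESCRIBED sections, then the round with
the slot's `C`», HSUBⁱ re-cut, rung `nose_lift_rung_three` BY NAME.
OURS; NAMED HYPOTHESES, not statements of any manuscript ([Hironaka2017] is a candidate under adjudication, nothing of it is asserted); AI-written, weaker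
than expert review; no `sorry`, no instance, no notation; standard axioms; EL♮(3) NOT proved; resolution in positive characteristic NOT proved (dim 3 =
Cossart–Piltant 2008/2009 in print).  `--kind definition --supports stmt-ResolutionOfSingularities-20148 --as helper`.  Names final on the desk's word.
-/

set_option linter.dupNamespace false
noncomputable section
open CategoryTheory CategoryTheory.Limits AlgebraicGeometry TopologicalSpace Topology IsLocalRing
open Literature.AlgebraicGeometry.Resolution
open AlgebraicGeometry.Scheme.IdealSheafData
namespace Summit.ResolutionOfSingularities.ResolutionOfSingularities.Cruxes.EquisingularLiftNat.Sections

/-- **`NoseLift₀ k n H ι Z hZ S hS`** — the ν-LIFT SUPPLIER SLOT (WIDTH TABLE D15, shape (B); idea-2 g30 sizing (i), desk R77a (1)): a CONCRETE `Prop`,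
centre-only, stated IN THE CONCRETE INITIAL MODEL `ℙⁿ_O` (the one stage whose chain-model is unique — the reason for shape (B), idea-2 (σ1) / typer T3).
For every admissible base `O` (adically complete DVR with algebraically closed residue field — HSUBʰ's `O`-block verbatim) with `θ : O → k` onto, and every
graded lift `φ` of the coordinates with `φ = MvPolynomial.map θ` (the `ELNatConclusionO` block verbatim; `Y := range (ι ≫ Proj.map φ)`, `q :=` the structure map
of `ℙⁿ_O`): (SECTIONS) `∃ 𝓢`, `V(𝓢)` regular, `𝓢 ↪ ℙⁿ_O → Spec O` flat, `𝓢.comap (Proj.map φ) = 𝓘⟨S⟩` (exact reduced trace = the point set `S`), support off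
the generic point of `Y`; and (CENTRE) for every `τ : X₁ ⟶ ℙⁿ_O` with `IsBlowup τ 𝓢`, every downstairs `υ : F₂ ⟶ ℙⁿ_k` with `IsBlowup υ 𝓘⟨S⟩` and every
model square `IsPullback j₁ t₁ (τ ≫ q) (Spec θ)` with `j₁ ≫ τ = υ ≫ Proj.map φ`: `∃ C : X₁.IdealSheafData`, `V(C)` regular, `C ↪ X₁ → Spec O` flat,
`C.comap j₁ = 𝓘⟨closure υ⁻¹(Z ∖ S)⟩`, `τ '' supp C` off the generic point of `Y`.  The parameter `hZ` is carried for uniformity only.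
[OURS · L1 W4.5b · named hypothesis fragment (supplier slot); no mathematical content of its own; consumed ONLY as a hypothesis] -/
def NoseLift₀ (k : Type) [Field k] (n : ℕ) (H : AlgebraicGeometry.Scheme.{0})
    (ι : H ⟶ (Literature.AlgebraicGeometry.Motives.projectiveSpace n k).left)
    (Z : Set (Literature.AlgebraicGeometry.Motives.projectiveSpace n k).left) (_hZ : IsClosed Z)
    (S : Set (Literature.AlgebraicGeometry.Motives.projectiveSpace n k).left) (hS : IsClosed S) : Prop :=
  ∀ (O : Type) [CommRing O] [IsDomain O] [IsDiscreteValuationRing O] [IsAdicComplete (IsLocalRing.maximalIdeal O) O]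
    [IsAlgClosed (IsLocalRing.ResidueField O)] (θ : O →+* k), Function.Surjective θ →
    (letI := MvPolynomial.gradedAlgebra (σ := Fin (n + 1)) (R := O); letI := MvPolynomial.gradedAlgebra (σ := Fin (n + 1)) (R := k);
     ∀ (φ : MvPolynomial.homogeneousSubmodule (Fin (n + 1)) O →+*ᵍ MvPolynomial.homogeneousSubmodule (Fin (n + 1)) k)
      (hφ' : HomogeneousIdeal.irrelevant (MvPolynomial.homogeneousSubmodule (Fin (n + 1)) k) ≤ (HomogeneousIdeal.irrelevant (MvPolynomial.homogeneousSubmodule (Fin (n + 1)) O)).map φ),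
      (∀ s, φ s = MvPolynomial.map θ s) →
      -- (SECTIONS) the supplier-chosen sections through `S`, in the concrete initial model `ℙⁿ_O`
      ∃ 𝓢 : (AlgebraicGeometry.Proj (MvPolynomial.homogeneousSubmodule (Fin (n + 1)) O)).IdealSheafData,
        Literature.AlgebraicGeometry.Resolution.Scheme.IsRegular 𝓢.subscheme ∧
        AlgebraicGeometry.Flat (𝓢.subschemeι ≫ (AlgebraicGeometry.Proj.toSpecZero (MvPolynomial.homogeneousSubmodule (Fin (n + 1)) O) ≫ AlgebraicGeometry.Spec.map (CommRingCat.ofHom (algebraMap O (MvPolynomial.homogeneousSubmodule (Fin (n + 1)) O 0))))) ∧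
        𝓢.comap (AlgebraicGeometry.Proj.map φ hφ' : (Literature.AlgebraicGeometry.Motives.projectiveSpace n k).left ⟶ (AlgebraicGeometry.Proj (MvPolynomial.homogeneousSubmodule (Fin (n + 1)) O))) =
          vanishingIdeal (⟨S, hS⟩ : Closeds (Literature.AlgebraicGeometry.Motives.projectiveSpace n k).left) ∧
        (𝓢.support : Set (AlgebraicGeometry.Proj (MvPolynomial.homogeneousSubmodule (Fin (n + 1)) O))) ⊆
          {y | ¬ IsGenericPoint y (Set.range (ι ≫ AlgebraicGeometry.Proj.map φ hφ' : H ⟶ (AlgebraicGeometry.Proj (MvPolynomial.homogeneousSubmodule (Fin (n + 1)) O))))} ∧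
        -- (CENTRE) in EVERY blow-up of the sections, over EVERY model square of it above the downstairs blow-up of `S`: a regular `O`-flat centre with exact
        -- reduced trace the strict transform `closure υ⁻¹(Z ∖ S)` of the nose curve
        ∀ (X₁ : AlgebraicGeometry.Scheme.{0}) (τ : X₁ ⟶ (AlgebraicGeometry.Proj (MvPolynomial.homogeneousSubmodule (Fin (n + 1)) O))),
          Literature.AlgebraicGeometry.Resolution.IsBlowup τ 𝓢 →
          ∀ (F₂ : AlgebraicGeometry.Scheme.{0}) (υ : F₂ ⟶ (Literature.AlgebraicGeometry.Motives.projectiveSpace n k).left),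
            Literature.AlgebraicGeometry.Resolution.IsBlowup υ (vanishingIdeal (⟨S, hS⟩ : Closeds (Literature.AlgebraicGeometry.Motives.projectiveSpace n k).left)) →
            ∀ (j₁ : F₂ ⟶ X₁) (t₁ : F₂ ⟶ AlgebraicGeometry.Spec (.of k)),
              IsPullback j₁ t₁ (τ ≫ (AlgebraicGeometry.Proj.toSpecZero (MvPolynomial.homogeneousSubmodule (Fin (n + 1)) O) ≫ AlgebraicGeometry.Spec.map (CommRingCat.ofHom (algebraMap O (MvPolynomial.homogeneousSubmodule (Fin (n + 1)) O 0)))))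
                (AlgebraicGeometry.Spec.map (CommRingCat.ofHom θ)) →
              j₁ ≫ τ = υ ≫ (AlgebraicGeometry.Proj.map φ hφ' : (Literature.AlgebraicGeometry.Motives.projectiveSpace n k).left ⟶ (AlgebraicGeometry.Proj (MvPolynomial.homogeneousSubmodule (Fin (n + 1)) O))) →
              ∃ C : X₁.IdealSheafData,
                Literature.AlgebraicGeometry.Resolution.Scheme.IsRegular C.subscheme ∧
                AlgebraicGeometry.Flat (C.subschemeι ≫ τ ≫ (AlgebraicGeometry.Proj.toSpecZero (MvPolynomial.homogeneousSubmodule (Fin (n + 1)) O) ≫ AlgebraicGeometry.Spec.map (CommRingCat.ofHom (algebraMap O (MvPolynomial.homogeneousSubmodule (Fin (n + 1)) O 0))))) ∧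
                C.comap j₁ = vanishingIdeal (⟨closure (υ ⁻¹' (Z \ S)), isClosed_closure⟩ : Closeds F₂) ∧
                τ '' (C.support : Set X₁) ⊆
                  {y | ¬ IsGenericPoint y (Set.range (ι ≫ AlgebraicGeometry.Proj.map φ hφ' : H ⟶ (AlgebraicGeometry.Proj (MvPolynomial.homogeneousSubmodule (Fin (n + 1)) O))))})

/-- **`ReachLiftNoseSigmaPG₂ k n H ι T₁ F₉ β T₉ E₉`** — door νLIFT «ν-LIFT NOSE» (WIDTH TABLE D15, SHAPE (B) of record, desk R77a (1); customer-candidate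
H₉ = π_P(S₃,₃), lead-1 `EQUISINGULAR-NOSES.md` 41a541edd1dfc560), INITIAL STAGE, NO HOST, DOOR-OWNED POINT STEPS: `E₉ = ∅`; a closed infinite nose curve
`Z ⊆ T₁`, `T₁ ⊄ Z`, the curve clause (= n-scope guard) and (N1) (✓ `ReachDirectCINoseSigmaPG₂`'s clauses VERBATIM); a closed point set `S` INSIDE THE
NON-REGULAR LOCUS of `Z̃` (amendment (σ2): any such `S`, `S = ∅` allowed — so ν3ᵈ/ν3ᶜⁱ/FREE-at-stage-0 are instances with `S = ∅`, THEOREM A with `S =` the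
triple points); the slot `NoseLift₀ k n H ι Z hZ S hS`; then the downstairs word: `υ : F₂ ⟶ ℙⁿ` the blow-up of `𝓘⟨S⟩`, the CURVE CLAUSE for the strict transform
`closure υ⁻¹(Z ∖ S)` at the new stage (rev2, nose-w1 g7 (z4): PHASE 2's letter, customer-certified like D6's `hZ₂dim`), `υ' : F₃ ⟶ F₂` the blow-up of that
strict transform, then a B‴ tail seeded at `(closure υ'⁻¹(closure υ⁻¹(T₁ ∖ S) ∖ closure υ⁻¹(Z ∖ S)), υ'⁻¹(closure υ⁻¹(Z ∖ S)), [], [], ∅)`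
with the ΣPG rule list VERBATIM at stage arguments `F₂ F₃ υ'` (`TowerPtRegB₄ → TowerPtRamB₄ → TowerRoundBTriplePrime → TowerSecRoundSigma → TowerPRamGamma`),
`β = γ' ≫ υ' ≫ υ`.  `T₁` is instantiated `Set.range ι` by the blob. [OURS · L1 W4.5b · named hypothesis fragment, no mathematical content of its own] -/
def ReachLiftNoseSigmaPG₂ (k : Type) [Field k] (n : ℕ) (H : AlgebraicGeometry.Scheme.{0})
    (ι : H ⟶ (Literature.AlgebraicGeometry.Motives.projectiveSpace n k).left)
    (T₁ : Set (Literature.AlgebraicGeometry.Motives.projectiveSpace n k).left) (F₉ : Scheme.{0}) (β : F₉ ⟶ (Literature.AlgebraicGeometry.Motives.projectiveSpace n k).left) (T₉ E₉ : Set F₉) : Prop :=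
  E₉ = ∅ ∧
  ∃ (Z : Set (Literature.AlgebraicGeometry.Motives.projectiveSpace n k).left) (hZ : IsClosed Z),
    Z ⊆ T₁ ∧ ¬ (T₁ ⊆ Z) ∧ Z.Infinite ∧
    -- curve clause (= the n-SCOPE guard)
    (∀ z : ↥(redSub (Literature.AlgebraicGeometry.Motives.projectiveSpace n k).left Z hZ), IsClosed ({z} : Set ↥(redSub (Literature.AlgebraicGeometry.Motives.projectiveSpace n k).left Z hZ)) →
      ringKrullDim ((redSub (Literature.AlgebraicGeometry.Motives.projectiveSpace n k).left Z hZ).presheaf.stalk z) = ((1 : ℕ) : WithBot ℕ∞)) ∧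
    -- (N1) finitely many non-regular points of the reduced nose `Z̃`
    Set.Finite {z : ↥(redSub (Literature.AlgebraicGeometry.Motives.projectiveSpace n k).left Z hZ) |
      ¬ IsRegularLocalRing ((redSub (Literature.AlgebraicGeometry.Motives.projectiveSpace n k).left Z hZ).presheaf.stalk z)} ∧
    -- the DOOR-OWNED point set `S` (closed; inside the image of the non-regular locus of `Z̃`; `S = ∅` allowed) carrying the ν-LIFT SLOT
    ∃ (S : Set (Literature.AlgebraicGeometry.Motives.projectiveSpace n k).left) (hS : IsClosed S),
      S ⊆ {y : (Literature.AlgebraicGeometry.Motives.projectiveSpace n k).left |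
        ∃ z : ↥(redSub (Literature.AlgebraicGeometry.Motives.projectiveSpace n k).left Z hZ),
          ¬ IsRegularLocalRing ((redSub (Literature.AlgebraicGeometry.Motives.projectiveSpace n k).left Z hZ).presheaf.stalk z) ∧
          (redSubι (Literature.AlgebraicGeometry.Motives.projectiveSpace n k).left Z hZ z : (Literature.AlgebraicGeometry.Motives.projectiveSpace n k).left) = y} ∧
      NoseLift₀ k n H ι Z hZ S hS ∧
      -- the word: point steps at `S` (ONE blow-up of the reduced finite set), the nose round at the strict transform of `Z`, then a B‴ tail (ΣPG rule list verbatim)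
      ∃ (F₂ : Scheme.{0}) (υ : F₂ ⟶ (Literature.AlgebraicGeometry.Motives.projectiveSpace n k).left),
        IsBlowup υ (vanishingIdeal (⟨S, hS⟩ : Closeds (Literature.AlgebraicGeometry.Motives.projectiveSpace n k).left)) ∧
        -- curve clause for the STRICT TRANSFORM `closure υ⁻¹(Z ∖ S)` of the nose curve at the new stage (PHASE 2's letter; customer-certified like the
        -- equinodal door's `hZ₂dim` — nose-w1 g7 ‼ l.87116 (z4); (z1) `Z₂ ⊆ T₂`, (z2) `¬ T₂ ⊆ Z₂`, (z3) `Z₂.Infinite` are DERIVED in the engine)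
        (∀ z : ↥(redSub F₂ (closure (υ ⁻¹' (Z \ S))) isClosed_closure), IsClosed ({z} : Set ↥(redSub F₂ (closure (υ ⁻¹' (Z \ S))) isClosed_closure)) →
          ringKrullDim ((redSub F₂ (closure (υ ⁻¹' (Z \ S))) isClosed_closure).presheaf.stalk z) = ((1 : ℕ) : WithBot ℕ∞)) ∧
        ∃ (F₃ : Scheme.{0}) (υ' : F₃ ⟶ F₂),
          IsBlowup υ' (vanishingIdeal (⟨closure (υ ⁻¹' (Z \ S)), isClosed_closure⟩ : Closeds F₂)) ∧
          ∃ (γ' : F₉ ⟶ F₃) (E' : Set F₉) (Es' Ns' : List (Set F₉)) (K' : Set F₉),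
            (∀ R : (∀ G : Scheme.{0}, (G ⟶ F₃) → Set G → Set G → List (Set G) → List (Set G) → Set G → Prop),
              R F₃ (𝟙 F₃) (closure (υ' ⁻¹' (closure (υ ⁻¹' (T₁ \ S)) \ closure (υ ⁻¹' (Z \ S))))) (υ' ⁻¹' (closure (υ ⁻¹' (Z \ S)))) [] [] ∅ →
              TowerPtRegB₄ F₃ R → TowerPtRamB₄ F₃ R → TowerRoundBTriplePrime F₂ F₃ υ' (closure (υ ⁻¹' (Z \ S))) isClosed_closure R →
              TowerSecRoundSigma F₂ F₃ υ' (closure (υ ⁻¹' (Z \ S))) isClosed_closure R →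
              TowerPRamGamma F₂ F₃ υ' (closure (υ ⁻¹' (Z \ S))) isClosed_closure R →
              R F₉ γ' T₉ E' Es' Ns' K') ∧
            β = γ' ≫ υ' ≫ υ

/-- **`NoseHypHostedNestEquinodalDirectCILiftSigmaPGBTriplePrime₂ k n H ι`** (D15 blob E8, initial menu «((ν4 ∨ ν3ᵈΣPG) ∨ ν3ᶜⁱΣPG) ∨ νLIFT») —
✓ `NoseHypHostedNestEquinodalDirectCISigmaPGBTriplePrime₂` (…DefsE7, the ΣPG blob) VERBATIM except that the initial-stage nose menu has ONE MORE disjunct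
`ReachLiftNoseSigmaPG₂ k n H ι (Set.range ι) F₉ β T₉ E₉`.  More doors asked of `Q` ⇒ implied by the ΣPG blob (`…_of_directCISigmaPG₂` below, pure logic);
REPLACE shape «¬(ΣPG-blob) ↦ ¬(this blob)» (desk R77a (6): the D15 REPLACE after the 50th, own text pair).
[OURS · L1 W4.5b · named hypothesis, no mathematical content of its own] -/
def NoseHypHostedNestEquinodalDirectCILiftSigmaPGBTriplePrime₂ (k : Type) [Field k] [IsAlgClosed k] (n : ℕ) (H : AlgebraicGeometry.Scheme.{0})
    (ι : H ⟶ (Literature.AlgebraicGeometry.Motives.projectiveSpace n k).left) : Prop :=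
  letI := MvPolynomial.gradedAlgebra (σ := Fin (n + 1)) (R := k)
  ∃ (E₀ : Set (Literature.AlgebraicGeometry.Motives.projectiveSpace n k).left),
    (E₀ = ∅ ∨ ∃ ℓ : MvPolynomial (Fin (n + 1)) k, ℓ.IsHomogeneous 1 ∧ ℓ ≠ 0 ∧
      ¬ (Set.range ι ⊆ {y : (Literature.AlgebraicGeometry.Motives.projectiveSpace n k).left |
        ℓ ∈ (y : ProjectiveSpectrum (MvPolynomial.homogeneousSubmodule (Fin (n + 1)) k)).asHomogeneousIdeal}) ∧
      E₀ = {y : (Literature.AlgebraicGeometry.Motives.projectiveSpace n k).left |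
        ℓ ∈ (y : ProjectiveSpectrum (MvPolynomial.homogeneousSubmodule (Fin (n + 1)) k)).asHomogeneousIdeal}) ∧
    (∃ (F' : AlgebraicGeometry.Scheme.{0}) (ρ' : F' ⟶ (Literature.AlgebraicGeometry.Motives.projectiveSpace n k).left) (T' : Set F'),
      (∀ Q : (∀ F₁ : AlgebraicGeometry.Scheme.{0}, (F₁ ⟶ (Literature.AlgebraicGeometry.Motives.projectiveSpace n k).left) → Set F₁ → Set F₁ → Prop),
        Q (Literature.AlgebraicGeometry.Motives.projectiveSpace n k).left (𝟙 (Literature.AlgebraicGeometry.Motives.projectiveSpace n k).left) (Set.range ι) E₀ →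
        (∀ (F₁ F₂ : AlgebraicGeometry.Scheme.{0}) (ρ : F₁ ⟶ (Literature.AlgebraicGeometry.Motives.projectiveSpace n k).left) (T₁ E₁ : Set F₁)
            (x : ↥((AlgebraicGeometry.Scheme.IdealSheafData.vanishingIdeal (⟨closure T₁, isClosed_closure⟩ : TopologicalSpace.Closeds F₁))).subscheme) (υ : F₂ ⟶ F₁) (hx : IsClosed ({(((AlgebraicGeometry.Scheme.IdealSheafData.vanishingIdeal (⟨closure T₁, isClosed_closure⟩ : TopologicalSpace.Closeds F₁))).subschemeι x : F₁)} : Set F₁)),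
          Q F₁ ρ T₁ E₁ → ¬ IsRegularLocalRing (((AlgebraicGeometry.Scheme.IdealSheafData.vanishingIdeal (⟨closure T₁, isClosed_closure⟩ : TopologicalSpace.Closeds F₁))).subscheme.presheaf.stalk x) →
          IsRegularLocalRing (F₁.presheaf.stalk (((AlgebraicGeometry.Scheme.IdealSheafData.vanishingIdeal (⟨closure T₁, isClosed_closure⟩ : TopologicalSpace.Closeds F₁))).subschemeι x : F₁)) →
          ((((AlgebraicGeometry.Scheme.IdealSheafData.vanishingIdeal (⟨closure T₁, isClosed_closure⟩ : TopologicalSpace.Closeds F₁))).subschemeι x : F₁) ∈ closure E₁ → ∀ e : ↥(redSub F₁ (closure E₁) isClosed_closure), (redSubι F₁ (closure E₁) isClosed_closure e : F₁) = (((AlgebraicGeometry.Scheme.IdealSheafData.vanishingIdeal (⟨closure T₁, isClosed_closure⟩ : TopologicalSpace.Closeds F₁))).subschemeι x : F₁) →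
          IsRegularLocalRing ((redSub F₁ (closure E₁) isClosed_closure).presheaf.stalk e)) → Literature.AlgebraicGeometry.Resolution.IsBlowup υ
            (AlgebraicGeometry.Scheme.IdealSheafData.vanishingIdeal (⟨{(((AlgebraicGeometry.Scheme.IdealSheafData.vanishingIdeal (⟨closure T₁, isClosed_closure⟩ : TopologicalSpace.Closeds F₁))).subschemeι x : F₁)}, hx⟩ : TopologicalSpace.Closeds F₁)) →
          Q F₂ (υ ≫ ρ) (closure (υ ⁻¹' (T₁ \ {(((AlgebraicGeometry.Scheme.IdealSheafData.vanishingIdeal (⟨closure T₁, isClosed_closure⟩ : TopologicalSpace.Closeds F₁))).subschemeι x : F₁)}))) (closure (υ ⁻¹' (E₁ \ {(((AlgebraicGeometry.Scheme.IdealSheafData.vanishingIdeal (⟨closure T₁, isClosed_closure⟩ : TopologicalSpace.Closeds F₁))).subschemeι x : F₁)})))) →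
        -- STAGE-LEVEL HOSTED ROUND at a regular curve `Z` inside the host, unobstructed IN THE HOST (in-host NEST lines and the nose curve alike)
        (∀ (F₁ F₃ : AlgebraicGeometry.Scheme.{0}) (ρ : F₁ ⟶ (Literature.AlgebraicGeometry.Motives.projectiveSpace n k).left) (T₁ E₁ : Set F₁) (Z : Set F₁) (hZ : IsClosed Z) (υ' : F₃ ⟶ F₁),
          Q F₁ ρ T₁ E₁ → Z ⊆ closure E₁ → Z ⊆ T₁ → ¬ T₁ ⊆ Z → (∀ z : ↥(redSub F₁ Z hZ), IsRegularLocalRing ((redSub F₁ Z hZ).presheaf.stalk z)) →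
          (∀ (i : redSub F₁ Z hZ ⟶ redSub F₁ (closure E₁) isClosed_closure), i ≫ redSubι F₁ (closure E₁) isClosed_closure = redSubι F₁ Z hZ →
            ∀ z : ↥(redSub F₁ Z hZ), IsRegularLocalRing ((redSub F₁ (closure E₁) isClosed_closure).presheaf.stalk (i z))) → DirStepUnobs F₁ (closure E₁) isClosed_closure Z hZ →
          (∀ z : ↥(redSub F₁ Z hZ), IsClosed ({z} : Set ↥(redSub F₁ Z hZ)) → ringKrullDim ((redSub F₁ Z hZ).presheaf.stalk z) = ((1 : ℕ) : WithBot ℕ∞)) →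
          Literature.AlgebraicGeometry.Resolution.IsBlowup υ' (AlgebraicGeometry.Scheme.IdealSheafData.vanishingIdeal (⟨Z, hZ⟩ : TopologicalSpace.Closeds F₁)) →
          Q F₃ (υ' ≫ ρ) (closure (υ' ⁻¹' (T₁ \ Z))) (closure (υ' ⁻¹' (closure E₁ \ Z)))) →
        (∀ (F₁ : AlgebraicGeometry.Scheme.{0}) (ρ : F₁ ⟶ (Literature.AlgebraicGeometry.Motives.projectiveSpace n k).left) (T₁ E₁ : Set F₁) (F₉ : AlgebraicGeometry.Scheme.{0}) (β : F₉ ⟶ F₁) (T₉ E₉ : Set F₉),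
          Q F₁ ρ T₁ E₁ → ReachHostedNoseBTriplePrime F₁ T₁ E₁ F₉ β T₉ E₉ → Q F₉ (β ≫ ρ) T₉ E₉) →
        -- INITIAL-STAGE NOSE, host named as the hyperplane `E₀ = V₊(ℓ)`: door ν4 «EQUINODAL» OR door ν3ᵈΣPG «DIRECT PLANAR» (both inside the host) OR door ν3ᶜⁱΣPG
        -- «ci-DIRECT» (host-free, `ℓ` a dummy) OR — NEW, D15 — door νLIFT «ν-LIFT NOSE» (`ReachLiftNoseSigmaPG₂`: host-free, door-owned point steps at `S`, the
        -- round at the strict transform of `Z` with an upstairs centre handed by the slot `NoseLift₀`, then a B‴ tail)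
        (∀ (ℓ : MvPolynomial (Fin (n + 1)) k) (F₉ : AlgebraicGeometry.Scheme.{0}) (β : F₉ ⟶ (Literature.AlgebraicGeometry.Motives.projectiveSpace n k).left) (T₉ E₉ : Set F₉),
          Q (Literature.AlgebraicGeometry.Motives.projectiveSpace n k).left (𝟙 (Literature.AlgebraicGeometry.Motives.projectiveSpace n k).left) (Set.range ι) E₀ →
          E₀ = {y : (Literature.AlgebraicGeometry.Motives.projectiveSpace n k).left |
            ℓ ∈ (y : ProjectiveSpectrum (MvPolynomial.homogeneousSubmodule (Fin (n + 1)) k)).asHomogeneousIdeal} →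
          (((ReachEquinodalPlanarNose₂ k n ℓ (Set.range ι) F₉ β T₉ E₉ ∨ ReachDirectPlanarNoseSigmaPG₂ k n ℓ (Set.range ι) F₉ β T₉ E₉) ∨
              ReachDirectCINoseSigmaPG₂ k n (Set.range ι) F₉ β T₉ E₉) ∨
              ReachLiftNoseSigmaPG₂ k n H ι (Set.range ι) F₉ β T₉ E₉) →
            Q F₉ β T₉ E₉) → ∃ E' : Set F', Q F' ρ' T' E') ∧
      Literature.AlgebraicGeometry.Resolution.Scheme.IsRegular (AlgebraicGeometry.Scheme.IdealSheafData.vanishingIdeal (⟨closure T', isClosed_closure⟩ : TopologicalSpace.Closeds F')).subscheme)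

/-- the ΣPG blob (✓ DefsE7) ⇒ the D15 blob: a motive closed under the WIDER initial menu is closed under the ΣPG menu. [OURS · pure logic] -/
theorem noseHypHostedNestEquinodalDirectCILiftSigmaPGBTriplePrime₂_of_directCISigmaPG₂ (k : Type) [Field k] [IsAlgClosed k] (n : ℕ)
    (H : AlgebraicGeometry.Scheme.{0}) (ι : H ⟶ (Literature.AlgebraicGeometry.Motives.projectiveSpace n k).left)
    (h : NoseHypHostedNestEquinodalDirectCISigmaPGBTriplePrime₂ k n H ι) : NoseHypHostedNestEquinodalDirectCILiftSigmaPGBTriplePrime₂ k n H ι := by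
  obtain ⟨E₀, hE₀, F', ρ', T', hQ, hreg⟩ := h
  refine ⟨E₀, hE₀, F', ρ', T', fun Q hQ0 hpt hround hreach hmenu => hQ Q hQ0 hpt hround hreach ?_, hreg⟩
  intro ℓ F₉ β T₉ E₉ hQ₀ hE hR
  exact hmenu ℓ F₉ β T₉ E₉ hQ₀ hE (Or.inl hR)

/-- the Σ blob (✓ DefsE6) ⇒ the D15 blob. [OURS · pure logic] -/
theorem noseHypHostedNestEquinodalDirectCILiftSigmaPGBTriplePrime₂_of_directCISigma₂ (k : Type) [Field k] [IsAlgClosed k] (n : ℕ)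
    (H : AlgebraicGeometry.Scheme.{0}) (ι : H ⟶ (Literature.AlgebraicGeometry.Motives.projectiveSpace n k).left)
    (h : NoseHypHostedNestEquinodalDirectCISigmaBTriplePrime₂ k n H ι) : NoseHypHostedNestEquinodalDirectCILiftSigmaPGBTriplePrime₂ k n H ι :=
  noseHypHostedNestEquinodalDirectCILiftSigmaPGBTriplePrime₂_of_directCISigmaPG₂ k n H ι
    (noseHypHostedNestEquinodalDirectCISigmaPGBTriplePrime₂_of_directCISigma₂ k n H ι h)

/-- Contrapositive, as the D15 REPLACE cut «¬(ΣPG-blob) ↦ ¬(D15 blob)» consumes it: the new residue hypothesis implies the old one. [OURS · pure logic] -/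
theorem not_noseHypHostedNestEquinodalDirectCISigmaPGBTriplePrime₂_of_not_liftSigmaPG₂ (k : Type) [Field k] [IsAlgClosed k] (n : ℕ)
    (H : AlgebraicGeometry.Scheme.{0}) (ι : H ⟶ (Literature.AlgebraicGeometry.Motives.projectiveSpace n k).left)
    (h : ¬ NoseHypHostedNestEquinodalDirectCILiftSigmaPGBTriplePrime₂ k n H ι) : ¬ NoseHypHostedNestEquinodalDirectCISigmaPGBTriplePrime₂ k n H ι :=
  fun h' => h (noseHypHostedNestEquinodalDirectCILiftSigmaPGBTriplePrime₂_of_directCISigmaPG₂ k n H ι h')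

/-- … the Σ-level twin «¬(D15 blob) → ¬(Σ-blob)» (if the D15 REPLACE is cut over the 49th's Σ-residue, desk R77a (6) / R76d). [OURS · pure logic] -/
theorem not_noseHypHostedNestEquinodalDirectCISigmaBTriplePrime₂_of_not_liftSigmaPG₂ (k : Type) [Field k] [IsAlgClosed k] (n : ℕ)
    (H : AlgebraicGeometry.Scheme.{0}) (ι : H ⟶ (Literature.AlgebraicGeometry.Motives.projectiveSpace n k).left)
    (h : ¬ NoseHypHostedNestEquinodalDirectCILiftSigmaPGBTriplePrime₂ k n H ι) : ¬ NoseHypHostedNestEquinodalDirectCISigmaBTriplePrime₂ k n H ι :=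
  not_noseHypHostedNestEquinodalDirectCISigmaBTriplePrime₂_of_not_directCISigmaPG₂ k n H ι
    (not_noseHypHostedNestEquinodalDirectCISigmaPGBTriplePrime₂_of_not_liftSigmaPG₂ k n H ι h)

/-- … `¬ (D15 blob) → ¬ (47th blob)`. [OURS · pure logic] -/
theorem not_noseHypHostedNestEquinodalDirectCIBTriplePrime₂_of_not_liftSigmaPG₂ (k : Type) [Field k] [IsAlgClosed k] (n : ℕ)
    (H : AlgebraicGeometry.Scheme.{0}) (ι : H ⟶ (Literature.AlgebraicGeometry.Motives.projectiveSpace n k).left)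
    (h : ¬ NoseHypHostedNestEquinodalDirectCILiftSigmaPGBTriplePrime₂ k n H ι) : ¬ NoseHypHostedNestEquinodalDirectCIBTriplePrime₂ k n H ι :=
  not_noseHypHostedNestEquinodalDirectCIBTriplePrime₂_of_not_directCISigmaPG₂ k n H ι
    (not_noseHypHostedNestEquinodalDirectCISigmaPGBTriplePrime₂_of_not_liftSigmaPG₂ k n H ι h)

/-- … `¬ (D15 blob) → ¬ (46th blob)`. [OURS · pure logic] -/
theorem not_noseHypHostedNestEquinodalDirectBTriplePrime₂_of_not_liftSigmaPG₂ (k : Type) [Field k] [IsAlgClosed k] (n : ℕ)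
    (H : AlgebraicGeometry.Scheme.{0}) (ι : H ⟶ (Literature.AlgebraicGeometry.Motives.projectiveSpace n k).left)
    (h : ¬ NoseHypHostedNestEquinodalDirectCILiftSigmaPGBTriplePrime₂ k n H ι) : ¬ NoseHypHostedNestEquinodalDirectBTriplePrime₂ k n H ι :=
  not_noseHypHostedNestEquinodalDirectBTriplePrime₂_of_not_directCISigmaPG₂ k n H ι
    (not_noseHypHostedNestEquinodalDirectCISigmaPGBTriplePrime₂_of_not_liftSigmaPG₂ k n H ι h)

/-- … `¬ (D15 blob) → ¬ blob₃ᵉ v2`. [OURS · pure logic] -/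
theorem not_noseHypHostedNestEquinodalBTriplePrime₂_of_not_liftSigmaPG₂ (k : Type) [Field k] [IsAlgClosed k] (n : ℕ)
    (H : AlgebraicGeometry.Scheme.{0}) (ι : H ⟶ (Literature.AlgebraicGeometry.Motives.projectiveSpace n k).left)
    (h : ¬ NoseHypHostedNestEquinodalDirectCILiftSigmaPGBTriplePrime₂ k n H ι) : ¬ NoseHypHostedNestEquinodalBTriplePrime₂ k n H ι :=
  not_noseHypHostedNestEquinodalBTriplePrime₂_of_not_directCISigmaPG₂ k n H ι
    (not_noseHypHostedNestEquinodalDirectCISigmaPGBTriplePrime₂_of_not_liftSigmaPG₂ k n H ι h)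

/-- … `¬ (D15 blob) → ¬ blob₂`. [OURS · pure logic] -/
theorem not_noseHypHostedNestBTriplePrime₂_of_not_liftSigmaPG₂ (k : Type) [Field k] [IsAlgClosed k] (n : ℕ)
    (H : AlgebraicGeometry.Scheme.{0}) (ι : H ⟶ (Literature.AlgebraicGeometry.Motives.projectiveSpace n k).left)
    (h : ¬ NoseHypHostedNestEquinodalDirectCILiftSigmaPGBTriplePrime₂ k n H ι) : ¬ NoseHypHostedNestBTriplePrime₂ k n H ι :=
  not_noseHypHostedNestBTriplePrime₂_of_not_directCISigmaPG₂ k n H ι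
    (not_noseHypHostedNestEquinodalDirectCISigmaPGBTriplePrime₂_of_not_liftSigmaPG₂ k n H ι h)

/-- … `¬ (D15 blob) → ¬ NoseHypPointsFirstBTriplePrime`. [OURS · pure logic] -/
theorem not_noseHypPointsFirstBTriplePrime_of_not_liftSigmaPG₂ (k : Type) [Field k] [IsAlgClosed k] (n : ℕ)
    (H : AlgebraicGeometry.Scheme.{0}) (ι : H ⟶ (Literature.AlgebraicGeometry.Motives.projectiveSpace n k).left)
    (h : ¬ NoseHypHostedNestEquinodalDirectCILiftSigmaPGBTriplePrime₂ k n H ι) : ¬ NoseHypPointsFirstBTriplePrime k n H ι :=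
  not_noseHypPointsFirstBTriplePrime_of_not_directCISigmaPG₂ k n H ι
    (not_noseHypHostedNestEquinodalDirectCISigmaPGBTriplePrime₂_of_not_liftSigmaPG₂ k n H ι h)

end Summit.ResolutionOfSingularities.ResolutionOfSingularities.Cruxes.EquisingularLiftNat.Sections

end
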